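import Literature.Barriers.RiemannHypothesis.FeketePolyaPositivityLaplaceProofs
import Mathlib.MeasureTheory.Integral.IntegralEqImproper
import Mathlib.Analysis.SpecialFunctions.Log.Deriv
import HarnessLib

/-!
# The `L(1, χ)` threshold of the Fekete–Pólya / Chowla positivity technique, at every order and through induced characters (Louboutin 2003, Theorem 1) — PROVED

Fourth proof sibling of the barrier catalogue entry
`Literature/Barriers/RiemannHypothesis/FeketePolyaPositivity.lean` (`FeketePolyaPositivity`:
the technique "`S_k(N, χ) ≥ 0` for all `N ≥ 1` and some order `k` ⟹ `L(σ, χ) > 0` for all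
`σ > 0`", named fact `FeketePolya1912`, proved in `FeketePolyaPositivityLaplaceProofs.lean`, and
Heilbronn's obstruction at `χ_{−163}`), written by the fourth barrier audit (2026-08-17) of the
sibling `FeketePolyaPositivityProofs.lean`. That entry's `scope_caveats` quoted, as "literature
scope of the obstruction, not formalised":

  "`L(1, χ) ≤ 1 − log 2 ⇒ m(χ) = ∞` for every real non-principal `χ`, primitive or not
  [Louboutin 2003, Theorem 1] … so on a primitive character the technique is void precisely in
  the small-`L(1, χ)` regime of the exceptional-zero problem (`ExceptionalZero`, rh.S34), and any
  use of it there must go through induced characters of astronomically large modulus"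

(only the ORDER-ONE threshold `L(1, χ) ≥ 1/2` was in the tree:
`half_le_re_LFunction_one_of_summatory_nonneg`, `FeketePolyaPositivityHeilbronn.lean`). Here the
ALL-ORDERS threshold is **proved**, for Mathlib's analytically continued
`DirichletCharacter.LFunction` and any `χ ≠ χ₀` (realness is not needed for the inequality on
`Re L(1, χ)`), together with its transport through induced characters — which is the form in
which it constrains the one known way around the barrier (Chowla's induced-character device,
`evasions_known` of the entry; `FeketePolyaPositivityChowla.lean`):

* `lt_re_LFunction_one_of_iterSummatory_nonneg` — "Theorem 1. If `L(1, χ) ≤ 1 − log 2 =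
  0.306852…` then `m(χ) = ∞` (i.e., there does not exist any `m ≥ 0` such that `S_χ^{(m)}(n) ≥ 0`
  for all `n ≥ 1`)" [Louboutin 2003, Theorem 1, p. 208], in the contrapositive form
  `(∃ k, ∀ N ≥ 1, S_k(N, χ) ≥ 0) ⟹ 1 − log 2 < Re L(1, χ)`; the refutation-shaped corollary is
  `feketePolya_hypothesis_fails_of_re_LFunction_one_le`.
* `lt_re_LFunction_one_mul_eulerFactors_of_induced` — if some character `χ↑m` INDUCED by the real
  character `χ ≠ χ₀` mod `d` (`d ∣ m`) satisfies the Fekete–Pólya hypothesis at some order `k`,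
  then `1 − log 2 < Re L(1, χ) · ∏_{p ∣ m} (1 − χ(p)/p)` (Louboutin's theorem for `χ↑m`, whose
  `L(1)` is `L(1, χ) ∏_{p ∣ m}(1 − χ(p) p^{−1})`, Mathlib `DirichletCharacter.LFunction_changeLevel`);
  corollary `feketePolya_hypothesis_fails_induced_of_le`. Since split primes (`χ(p) = 1`) only
  lower the product and ramified ones (`χ(p) = 0`) do not change it, this says: an order-`k`
  certificate for `L(σ, χ) > 0` through ANY induced character needs a set `T` of inert primes in
  the modulus with `∏_{p ∈ T} (1 + 1/p) > (1 − log 2) / L(1, χ)`. By Mertens' theorem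
  `∏_{p ≤ z}(1 + 1/p) ~ (6 e^γ/π²) log z`, so in the exceptional-zero regime `L(1, χ) → 0` the
  modulus `m ≥ ∏_{p ∈ T} p` of any such certificate satisfies `log log m ≫ 1 / L(1, χ)` — doubly
  exponential in `1/L(1, χ)`; this quantifies "astronomically large" in the entry (the Mertens
  step is not formalised here). At `χ_{−163}` (`L(1, χ) = π/√163 = 0.2461`) the threshold only
  demands `∏_{p ∈ T}(1 + 1/p) > 1.247`, i.e. at least one inert prime — there the binding
  constraint is Heilbronn's numerics instead (eighteen inert primes: `evasions_known`, gen 3).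

## The argument (Laplace side; Louboutin argues on the Dirichlet-series side with the same extremal function)

By `Gamma_mul_re_LFunction_eq_integral` (`FeketePolyaPositivityLaplaceProofs.lean`; MV §5.1
(5.23)) at `σ = 1`: `Re L(1, χ) = ∫_0^∞ P(e^{−t}) dt` with `P(z) = ∑ Re χ(n) zⁿ`. If some
`S_k(·, χ) ≥ 0` then `P > 0` on `(0, 1)` (`powerSeries_pos_of_iterSummatory_nonneg`, MV Exercise
11.2.1.7 (j)), so the part of the integral over `0 < t ≤ log 2` is positive; and for every
`t > log 2`, i.e. `z = e^{−t} < 1/2`, unconditionally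
`P(z) ≥ z − ∑_{n ≥ 2} zⁿ = z − z²/(1 − z)` (`sub_le_powerSeries`: `Re χ(1) = 1`, `|Re χ(n)| ≤ 1`;
this is `P(z, f)` for Louboutin's comparison function `f = (1, −1, −1, …)` [Louboutin 2003,
proof of Proposition 3]), whose integral over `(log 2, ∞)` is
`[−2e^{−t} − log(1 − e^{−t})]_{log 2}^{∞} = 1 − log 2` (`integral_Ioi_exp_neg_sub`). Hence
`Re L(1, χ) > 1 − log 2`. (Louboutin's Proposition 3 gives the sharper order-dependent bound
`L(1, χ) ≥ 1 − ∑_{n=1}^{m} 1/(n+m)`, decreasing to `1 − log 2`; [Louboutin 2013, Theorem 1.2]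
improves the constant under side conditions, e.g. `0.373043` when `χ(2) = −1`. Neither refinement
is needed for the barrier statement and neither is formalised.)

## References

* [Louboutin2003] S. R. Louboutin, *Note on a hypothesis implying the non-vanishing of Dirichlet
  L-series `L(s, χ)` for `s > 0` and real characters `χ`*, Colloq. Math. 96 (2003), 207–212 —
  READ: Theorem 1 and Proposition 3 with its proof, pp. 207–209.
* [Louboutin2013Chowla] S. Louboutin, Colloq. Math. 130 (2013), 79–90 — read: Theorem 1.2, p. 80
  (sharper constants; not formalised).
* [ChowlaKesslerLivingston1977] S. Chowla, I. Kessler, M. Livingston, Acta Arith. 33 (1977),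
  81–87 — READ in full by this audit: p. 85 states the induced-character conjecture in its
  primary form ("HYPOTHESIS J. To every odd real primitive character `χ mod k` there exists a
  real principal character `χ₀ mod k′` such that `∑_{n ≤ x} χ(n)χ₀(n) ≥ 0` for all `x`",
  attributed to Chowla–DeLeon–Hartung 1973) — for ODD characters only, confirming that the
  parity-blind `ChowlaConjecture1972` of the catalogue entry is Montgomery–Vaughan's
  transcription — and records H. L. Montgomery's suggested converse ("If `L(s, χ) ≠ 0` for
  `0 < s < 1` then there is a character `χ′`, induced by `χ`, such that `∑_{n ≤ x} χ′(n) ≥ 0` for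
  all `x ≥ 0`"), under which the present threshold is the only obstruction of its kind.
* [MontgomeryVaughan2007] H. L. Montgomery, R. C. Vaughan, *Multiplicative Number Theory I*,
  §5.1 (5.23) and §11.2.1 Exercise 7 (j) (through the sibling files).

## Design notes

* As in the siblings: `S_k = iterSummatory (fun n ↦ Re χ(n)) k`, "`L(1, χ)`" is
  `Re (DirichletCharacter.LFunction χ 1)`, "`χ` real" is `χ ^ 2 = 1`, "induced" is
  `DirichletCharacter.changeLevel`; the Euler factor at `σ = 1` is written `1 − Re χ(p) · p^{−1}`
  with a real power `(p : ℝ) ^ (−1 : ℝ)`, exactly as `re_LFunction_changeLevel_ofReal` delivers it.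
* No definitions are introduced; the comparison kernel `e^{−t} − e^{−2t}/(1 − e^{−t})` and its
  primitive `−2e^{−t} − log(1 − e^{−t})` are written out.
-/

noncomputable section

open Finset Filter Topology MeasureTheory Set

namespace Literature.Barriers.RiemannHypothesis

/-! ## The comparison series: `P(z) ≥ z − z²/(1 − z)` -/

section PowerSeries

variable (f : ℕ → ℝ) (hf0 : f 0 = 0) (hf : ∀ n, |f n| ≤ 1)
include hf0 hf

/-- For `f(0) = 0`, `f(1) = 1`, `|f| ≤ 1` and `0 ≤ z < 1`:
`∑ f(n) zⁿ ≥ z − ∑_{n ≥ 2} zⁿ = z − z²/(1 − z)` — the power series of `f` dominates that of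
Louboutin's comparison function `(1, −1, −1, …)`. [cite: Louboutin2003, proof of Proposition 3] -/
theorem sub_le_powerSeries (hf1 : f 1 = 1) {z : ℝ} (hz0 : 0 ≤ z) (hz1 : z < 1) :
    z - z ^ 2 / (1 - z) ≤ ∑' n : ℕ, f n * z ^ n := by
  have hS : Summable fun n : ℕ ↦ f n * z ^ n :=
    (summable_norm_iterSummatory_mul_pow f hf 0 hz0 hz1).of_norm
  have hg : Summable fun i : ℕ ↦ z ^ 2 * z ^ i := (summable_geometric_of_lt_one hz0 hz1).mul_left _
  have htail : Summable fun i : ℕ ↦ f (i + 2) * z ^ (i + 2) := (summable_nat_add_iff 2).2 hS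
  have hle : ∀ i : ℕ, -(z ^ 2 * z ^ i) ≤ f (i + 2) * z ^ (i + 2) := fun i ↦ by
    have h1 : -1 ≤ f (i + 2) := (abs_le.1 (hf (i + 2))).1
    have h2 : 0 ≤ z ^ 2 * z ^ i := by positivity
    rw [pow_add, mul_comm (z ^ i)]
    nlinarith
  have h2 := Summable.tsum_le_tsum hle hg.neg htail
  rw [tsum_neg, tsum_mul_left, tsum_geometric_of_lt_one hz0 hz1] at h2
  rw [← hS.sum_add_tsum_nat_add 2, Finset.sum_range_succ, Finset.sum_range_succ,
    Finset.sum_range_zero, hf0, hf1]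
  have : z ^ 2 / (1 - z) = z ^ 2 * (1 - z)⁻¹ := div_eq_mul_inv _ _
  simp only [zero_mul, zero_add, one_mul, pow_one]
  linarith

end PowerSeries

/-! ## The comparison kernel `e^{−t} − e^{−2t}/(1 − e^{−t})` integrates to `1 − log 2` over `(log 2, ∞)` -/

/-- `d/dt (−2e^{−t} − log(1 − e^{−t})) = e^{−t} − e^{−2t}/(1 − e^{−t})` for `t > 0`. [folklore] -/
theorem hasDerivAt_neg_two_mul_exp_neg_sub_log {t : ℝ} (ht : 0 < t) :
    HasDerivAt (fun u : ℝ ↦ -2 * Real.exp (-u) - Real.log (1 - Real.exp (-u)))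
      (Real.exp (-t) - Real.exp (-t) ^ 2 / (1 - Real.exp (-t))) t := by
  have he : HasDerivAt (fun u : ℝ ↦ Real.exp (-u)) (-Real.exp (-t)) t := by
    simpa using ((hasDerivAt_id t).neg).exp
  have hlt : Real.exp (-t) < 1 := Real.exp_lt_one_iff.2 (by linarith)
  have hne : 1 - Real.exp (-t) ≠ 0 := by linarith
  have hl : HasDerivAt (fun u : ℝ ↦ Real.log (1 - Real.exp (-u)))
      ((0 - -Real.exp (-t)) / (1 - Real.exp (-t))) t :=
    ((hasDerivAt_const t (1 : ℝ)).sub he).log hne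
  have key : Real.exp (-t) - Real.exp (-t) ^ 2 / (1 - Real.exp (-t)) =
      -2 * -Real.exp (-t) - (0 - -Real.exp (-t)) / (1 - Real.exp (-t)) := by
    field_simp
    ring
  rw [key]
  exact (he.const_mul (-2)).sub hl

/-- The kernel is non-negative for `t ≥ log 2` (`z = e^{−t} ≤ 1/2`:
`z − z²/(1 − z) = z(1 − 2z)/(1 − z)`). [folklore] -/
theorem exp_neg_sub_nonneg {t : ℝ} (ht : Real.log 2 ≤ t) :
    0 ≤ Real.exp (-t) - Real.exp (-t) ^ 2 / (1 - Real.exp (-t)) := by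
  have hz : Real.exp (-t) ≤ 1 / 2 := by
    have h := Real.exp_le_exp.2 (neg_le_neg ht)
    rwa [Real.exp_neg (Real.log 2), Real.exp_log two_pos, inv_eq_one_div] at h
  have hpos : 0 < 1 - Real.exp (-t) := by linarith
  have h0 : 0 ≤ Real.exp (-t) := (Real.exp_pos _).le
  rw [sub_nonneg, div_le_iff₀ hpos]
  nlinarith

/-- The primitive `−2e^{−t} − log(1 − e^{−t})` tends to `0` at `+∞`. [folklore] -/
theorem tendsto_neg_two_mul_exp_neg_sub_log :
    Tendsto (fun u : ℝ ↦ -2 * Real.exp (-u) - Real.log (1 - Real.exp (-u))) atTop (𝓝 0) := by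
  have h := Real.tendsto_exp_neg_atTop_nhds_zero
  have h1 : Tendsto (fun u : ℝ ↦ Real.log (1 - Real.exp (-u))) atTop (𝓝 (Real.log (1 - 0))) :=
    (tendsto_const_nhds.sub h).log (by norm_num)
  have h2 := (h.const_mul (-2)).sub h1
  simpa using h2

/-- The kernel is integrable on `(log 2, ∞)`. [folklore] -/
theorem integrableOn_exp_neg_sub :
    IntegrableOn (fun t : ℝ ↦ Real.exp (-t) - Real.exp (-t) ^ 2 / (1 - Real.exp (-t)))
      (Ioi (Real.log 2)) :=
  integrableOn_Ioi_deriv_of_nonneg'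
    (fun _ ht ↦ hasDerivAt_neg_two_mul_exp_neg_sub_log ((Real.log_pos one_lt_two).trans_le ht))
    (fun _ ht ↦ exp_neg_sub_nonneg (le_of_lt ht)) tendsto_neg_two_mul_exp_neg_sub_log

/-- `∫_{log 2}^∞ (e^{−t} − e^{−2t}/(1 − e^{−t})) dt = 1 − log 2` (substituting `z = e^{−t}`:
`∫_0^{1/2} (1 − z/(1 − z)) dz = [2z + log(1 − z)]_0^{1/2}`; here by the primitive
`−2e^{−t} − log(1 − e^{−t})`; termwise this is `1/2 − ∑_{n ≥ 2} 2^{−n}/n`, the value of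
Louboutin's bound at `m → ∞`). [cite: Louboutin2003, Proposition 3] -/
theorem integral_Ioi_exp_neg_sub :
    ∫ t in Ioi (Real.log 2), (Real.exp (-t) - Real.exp (-t) ^ 2 / (1 - Real.exp (-t))) =
      1 - Real.log 2 := by
  rw [integral_Ioi_of_hasDerivAt_of_nonneg'
    (fun _ ht ↦ hasDerivAt_neg_two_mul_exp_neg_sub_log ((Real.log_pos one_lt_two).trans_le ht))
    (fun _ ht ↦ exp_neg_sub_nonneg (le_of_lt ht)) tendsto_neg_two_mul_exp_neg_sub_log]
  rw [Real.exp_neg, Real.exp_log two_pos]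
  have : Real.log (1 - (2 : ℝ)⁻¹) = -Real.log 2 := by
    rw [show (1 : ℝ) - 2⁻¹ = 2⁻¹ by norm_num, Real.log_inv]
  rw [this]
  ring

/-! ## `∫_0^∞ P(e^{−t}) dt > 1 − log 2` under the Fekete–Pólya hypothesis -/

section Laplace

variable (f : ℕ → ℝ) (hf0 : f 0 = 0) (hf : ∀ n, |f n| ≤ 1)
include hf0 hf

/-- If `f(0) = 0`, `f(1) = 1`, `|f| ≤ 1`, `|S_1(N)| ≤ B` and `S_k(N) ≥ 0` for all `N ≥ 1` (some
order `k`), then `∫_0^∞ t^{1−1} P(e^{−t}) dt > 1 − log 2` (`P(z) = ∑ f(n) zⁿ`): on `(0, log 2]`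
the integrand is positive (MV (j)), on `(log 2, ∞)` it is at least the comparison kernel.
[cite: Louboutin2003, Proposition 3] -/
theorem lt_integral_powerSeries (hf1 : f 1 = 1) {B : ℝ} (hB : ∀ N, |summatory f N| ≤ B)
    {k : ℕ} (hk : ∀ N : ℕ, 1 ≤ N → 0 ≤ iterSummatory f k N) :
    1 - Real.log 2 <
      ∫ t in Ioi (0 : ℝ), t ^ ((1 : ℝ) - 1) * ∑' n : ℕ, f n * Real.exp (-t) ^ n := by
  have hint := integrableOn_rpow_mul_powerSeries f hf0 hf hB one_pos
  have hfun : (fun t : ℝ ↦ t ^ ((1 : ℝ) - 1) * ∑' n : ℕ, f n * Real.exp (-t) ^ n) =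
      fun t : ℝ ↦ ∑' n : ℕ, f n * Real.exp (-t) ^ n := by
    funext t
    rw [sub_self, Real.rpow_zero, one_mul]
  rw [hfun] at hint ⊢
  have h2 : 0 < Real.log 2 := Real.log_pos one_lt_two
  have hpos : ∀ t : ℝ, 0 < t → 0 < ∑' n : ℕ, f n * Real.exp (-t) ^ n := fun t ht ↦
    powerSeries_pos_of_iterSummatory_nonneg f hf0 hf (by rw [hf1]; exact one_pos) hk
      (Real.exp_pos _) (Real.exp_lt_one_iff.2 (by linarith))
  have hsplit : ∫ t in Ioi (0 : ℝ), ∑' n : ℕ, f n * Real.exp (-t) ^ n =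
      (∫ t in Ioc (0 : ℝ) (Real.log 2), ∑' n : ℕ, f n * Real.exp (-t) ^ n) +
        ∫ t in Ioi (Real.log 2), ∑' n : ℕ, f n * Real.exp (-t) ^ n := by
    rw [← Ioc_union_Ioi_eq_Ioi h2.le, setIntegral_union (Ioc_disjoint_Ioi le_rfl)
      measurableSet_Ioi (hint.mono_set Ioc_subset_Ioi_self)
      (hint.mono_set (Ioi_subset_Ioi h2.le))]
  have hIoc : 0 < ∫ t in Ioc (0 : ℝ) (Real.log 2), ∑' n : ℕ, f n * Real.exp (-t) ^ n := by
    rw [setIntegral_pos_iff_support_of_nonneg_ae]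
    · have : Function.support (fun t : ℝ ↦ ∑' n : ℕ, f n * Real.exp (-t) ^ n) ∩
          Ioc (0 : ℝ) (Real.log 2) = Ioc (0 : ℝ) (Real.log 2) :=
        inter_eq_right.2 fun t ht ↦ Function.mem_support.2 (hpos t ht.1).ne'
      rw [this, Real.volume_Ioc, sub_zero, ENNReal.ofReal_pos]
      exact h2
    · exact (ae_restrict_iff' measurableSet_Ioc).2
        (Eventually.of_forall fun t ht ↦ (hpos t ht.1).le)
    · exact hint.mono_set Ioc_subset_Ioi_self
  have hIoi : 1 - Real.log 2 ≤ ∫ t in Ioi (Real.log 2), ∑' n : ℕ, f n * Real.exp (-t) ^ n := by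
    rw [← integral_Ioi_exp_neg_sub]
    refine setIntegral_mono_on integrableOn_exp_neg_sub (hint.mono_set (Ioi_subset_Ioi h2.le))
      measurableSet_Ioi fun t ht ↦ ?_
    have ht0 : 0 < t := h2.trans ht
    exact sub_le_powerSeries f hf0 hf hf1 (Real.exp_pos _).le
      (Real.exp_lt_one_iff.2 (by linarith))
  rw [hsplit]
  linarith

end Laplace

/-! ## Louboutin's theorem for `L(1, χ)` and its transport through induced characters -/

variable {q : ℕ} [NeZero q] (χ : DirichletCharacter ℂ q)

/-- **Louboutin 2003, Theorem 1, PROVED**: "If `L(1, χ) ≤ 1 − log 2 = 0.306852…` then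
`m(χ) = ∞` (i.e., there does not exist any `m ≥ 0` such that `S_χ^{(m)}(n) ≥ 0` for all
`n ≥ 1`)", for "a real non-principal Dirichlet character (we do not assume that `χ` is
primitive)" — here in the contrapositive, for ANY `χ ≠ χ₀` mod `q` (realness not needed) and
Mathlib's analytically continued `LFunction`: if `S_k(N, χ) ≥ 0` for all `N ≥ 1` at some order
`k`, then `1 − log 2 < Re L(1, χ)`. (Louboutin indexes from `S^{(0)} = χ`; our `iterSummatory · 0`
is `Re χ` itself, so the orders agree.) [cite: Louboutin2003, Theorem 1] -/
theorem lt_re_LFunction_one_of_iterSummatory_nonneg (hχ : χ ≠ 1) {k : ℕ}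
    (hS : ∀ N : ℕ, 1 ≤ N → 0 ≤ iterSummatory (fun n ↦ (χ (n : ZMod q)).re) k N) :
    1 - Real.log 2 < (χ.LFunction 1).re := by
  have h := lt_integral_powerSeries _ (re_apply_natCast_zero χ hχ) (abs_re_apply_natCast_le χ)
    (by simp) (abs_summatory_re_le χ hχ) hS
  rw [← Gamma_mul_re_LFunction_eq_integral χ hχ one_pos, Real.Gamma_one, one_mul,
    Complex.ofReal_one] at h
  exact h

/-- Barrier form of Louboutin's theorem: if `Re L(1, χ) ≤ 1 − log 2` (`χ ≠ χ₀`), the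
Fekete–Pólya hypothesis fails for `χ` at EVERY order `k` — the technique `FeketePolya1912` is
void for `χ`. [cite: Louboutin2003, Theorem 1] -/
theorem feketePolya_hypothesis_fails_of_re_LFunction_one_le (hχ : χ ≠ 1)
    (h : (χ.LFunction 1).re ≤ 1 - Real.log 2) (k : ℕ) :
    ¬ ∀ N : ℕ, 1 ≤ N → 0 ≤ iterSummatory (fun n ↦ (χ (n : ZMod q)).re) k N :=
  fun hS ↦ (lt_re_LFunction_one_of_iterSummatory_nonneg χ hχ hS).not_ge h

omit [NeZero q] χ in
/-- **Louboutin's threshold through induced characters, PROVED**: if `χ ≠ χ₀` is a real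
character mod `d`, `d ∣ m`, and the induced character `χ↑m` satisfies the Fekete–Pólya
hypothesis at some order `k` (`S_k(N, χ↑m) ≥ 0` for all `N ≥ 1`), then
`1 − log 2 < Re L(1, χ) · ∏_{p ∣ m} (1 − Re χ(p) · p^{−1})` — Theorem 1 for `χ↑m`, whose value at
`1` is `L(1, χ) ∏_{p ∣ m}(1 − χ(p) p^{−1})` ("if `ψ mod fd` is induced by `χ mod f`, then
`L(s, ψ) = L(s, χ) ∏_{p ∣ d}(1 − χ(p)/p^s)`"). So a certificate through an induced character
needs inert primes `T` in the modulus with `∏_{p ∈ T}(1 + 1/p) > (1 − log 2)/Re L(1, χ)`.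
[cite: Louboutin2003, Theorem 1] [cite: Louboutin2013Chowla, eq. (1), p. 81] -/
theorem lt_re_LFunction_one_mul_eulerFactors_of_induced {d m : ℕ} [NeZero d] [NeZero m]
    (hm : d ∣ m) (χ : DirichletCharacter ℂ d) (hχ : χ ≠ 1) (hχ2 : χ ^ 2 = 1) {k : ℕ}
    (hS : ∀ N : ℕ, 1 ≤ N → 0 ≤ iterSummatory
      (fun n ↦ (DirichletCharacter.changeLevel hm χ (n : ZMod m)).re) k N) :
    1 - Real.log 2 <
      (χ.LFunction 1).re * ∏ p ∈ m.primeFactors, (1 - (χ (p : ZMod d)).re * (p : ℝ) ^ (-(1 : ℝ))) := by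
  have h1 : DirichletCharacter.changeLevel hm χ ≠ 1 := fun h' ↦
    hχ ((DirichletCharacter.changeLevel_eq_one_iff hm).mp h')
  have h := lt_re_LFunction_one_of_iterSummatory_nonneg _ h1 hS
  have key := re_LFunction_changeLevel_ofReal hm χ hχ hχ2 1
  rw [Complex.ofReal_one] at key
  rwa [key] at h

omit [NeZero q] χ in
/-- Barrier form through induced characters: if `Re L(1, χ) · ∏_{p ∣ m}(1 − Re χ(p) p^{−1}) ≤ 1 − log 2`
for the real character `χ ≠ χ₀` mod `d ∣ m`, then NO order `k` of the Fekete–Pólya hypothesis is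
available for the induced character `χ↑m` — Chowla's induced-character device cannot be run
through the modulus `m`. In the exceptional-zero regime (`L(1, χ)` small) this excludes every
modulus whose inert prime factors `T` have `∏_{p ∈ T}(1 + 1/p) ≤ (1 − log 2)/L(1, χ)`.
[cite: Louboutin2003, Theorem 1] -/
theorem feketePolya_hypothesis_fails_induced_of_le {d m : ℕ} [NeZero d] [NeZero m]
    (hm : d ∣ m) (χ : DirichletCharacter ℂ d) (hχ : χ ≠ 1) (hχ2 : χ ^ 2 = 1)
    (h : (χ.LFunction 1).re *
        ∏ p ∈ m.primeFactors, (1 - (χ (p : ZMod d)).re * (p : ℝ) ^ (-(1 : ℝ))) ≤ 1 - Real.log 2)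
    (k : ℕ) :
    ¬ ∀ N : ℕ, 1 ≤ N → 0 ≤ iterSummatory
      (fun n ↦ (DirichletCharacter.changeLevel hm χ (n : ZMod m)).re) k N :=
  fun hS ↦ (lt_re_LFunction_one_mul_eulerFactors_of_induced hm χ hχ hχ2 hS).not_ge h

end Literature.Barriers.RiemannHypothesis

end
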